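import Summits.QuantumFields.BalabanUV.T4Continuum.Support.NE9BridgeSizeInduction

/-!
# NE9BridgeSizeInductionOn — LOCATED CORRECTION O-ne9p1g32-1 of the END's BOX BINDER `hbox`, kernel part 1: the size
# induction and the vacuum-subtracted bridge END re-cut with the box read-out asked ONLY AT ARISING TABLES (`hboxOn`)
# (cell `pub-balaban`, T4-DAG §2 node U3 ∕ §6 NE9; BINDER row NE9 OWNER lineage `b2b-balaban-t4-ne9-p1`, generation 32;
# sheet `t4/b2b-balaban-t4-ne9-p1/g32/TABLE-HALF-NE9-g32.md` §2 = finding OBJ-NE9-g32-1)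

HONEST FRAMING (T4-DAG PAGE 1).  Rung (B)+1 on a FIXED finite torus with `FlowStep.BetaPertH` and (B) explicit — NOT infinite
volume, NOT a mass gap, NOT the Clay problem.  NE9 (`T4OutputRate.NE9` ∧ `FadingMemory`) is a cell NEW ESTIMATE, NOT PRINTED in
[I] = [Balaban1987RG1] (CMP **109**), [II] = [Balaban1988RG2Cluster] (CMP **116**), NOT discharged here («NE9 ⇐ the named
binders»; 0∕18 leaves instantiated on Bałaban's objects; spine PROVED 0∕9).  HONEST DEPENDENCY (cell line, verbatim): continuum
YM on T⁴ ⇐ BetaPertH ∧ nine spine estimates (0/9 proved); BetaPertH ⇐ (D1) ∧ (D4) ∧ CAP+tail; G-an2-4 gates asym, D1 and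
NE2/3/4.  Bookkeeping over the ABSTRACT carriers; every analytic input a DISPLAYED binder; quotations for TYPES only (ABSOLUTE
RULE).  `FlowStep.BetaPertH`, (B), (B^μ) do not occur.  0 sorry.

THE FINDING (OBJ-NE9-g32-1, owner, located; class «binder stronger than used — blocks the natural instantiation»; nothing landed
is false).  Every END of the lineage from `NE9BridgeSizeInduction` upward displays the box read-out
`hbox : ∀ k (Q : ι → ℝ), (∀ y, |Q y| ≤ wt k y · sizeRadius τ N k) → ρ k Q ∈ 𝒜 k` — the (1.36)-weighted output BOX read into the
admissible configuration set `𝒜 k` of the activities, FOR EVERY TABLE OF THE BOX.  Its ONLY consumers are the two call sites of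
`NE9BridgeSizeInduction.termSize_of_recursion_vacSub` (and P2's `T4HistoryLipschitzSegment.termSize_of_recursion`), both at
ARISING tables `Q := T k g′ (E g)`, `g, g′ ∈ W` — the channel of the functional's OWN earlier family.  For the instantiation
(sheet §1: the table slot of NE9's chart face is read by NE5's measure-theoretic `activity … (hist : B13HistM P)`, whose `Hist` is
the CLOSED SUBSPACE of tables MEASURABLE in the field argument, `B13HistMeasurable`), the index `ι` of the species channel of record
codes the output domain, the chart point AND the field argument POINTWISE (`CurData`: `y ↦` the VALUE of the (1.23)-piece), so an
arbitrary table of the box is NOT a regular table: a TOTAL reading `ρ k` satisfying `hρ` (weighted 1-Lipschitz, all pairs) AND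
`hbox` (all of the box into an `𝒜 k` on which the DISPLAYED `TwoPointKP`∕`hCup` speak of Bałaban's activities) has no honest
construction — a junk branch for irregular tables violates `hρ` across the branch, and an `𝒜 k` containing irregular tables makes
the displayed `TwoPointKP` a statement about junk integrals.  Arising tables ARE regular (channels of ADMISSIBLE = analytic
families; [II] (1.34) p. 9: 𝐕′_k «defined and analytic on 𝔘^c_{k+1} × {B′}» — an M∕T-row of the instancer), so the binder the
END actually USES is instantiable.  REPAIR (this file + the pass-through twins up the chain): replace `hbox` by
`hboxOn : ∀ k, ∀ g ∈ W, ∀ g′ ∈ W, (∀ y, |T k g′ (E g) y| ≤ wt k y · sizeRadius τ N k) → ρ k (T k g′ (E g)) ∈ 𝒜 k`.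
* §1 **`termSize_of_recursion_vacSub_on`** — `NE9BridgeSizeInduction.termSize_of_recursion_vacSub` VERBATIM with `hbox ↦ hboxOn`
  (same 45-line strong induction; the two call sites are arising tables);
* §2 **`ne9_and_fadingMemory_of_couplingTwoPoint_vacSub_sizeInduction_on`** — §3 of that module VERBATIM with `hbox ↦ hboxOn`
  (the NE9 half `NE9VacuumSubtractedBridge.ne9_and_fadingMemory_of_couplingTwoPoint_vacSub` takes the DERIVED occupation `hocc`
  and is unchanged);
* §3 `hboxOn_of_hbox` — the old binder implies the new one (so every landed END is a COROLLARY of its `…_on` twin; nothing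
  landed is weakened or withdrawn).
The twins of the six pass-through layers (`NE9MarginalProjectionEnd` `…_compProj`∕`…_margProj`, `NE9ChannelSumMargProj`,
`NE9SizeFedCoupling` `…_fed`, `NE9Lemma1SpeciesEnd`, `NE9SizeFedCouplingSpecies(ReadOut)` `…_fedA3`) are mechanical (binder text
`hbox ↦ hboxOn`, callee `↦ …_on`) and follow.  DISGUISE TEST: no new estimate; a binder WEAKENED to its use.

References (TYPES only): [Balaban1987RG1] T. Bałaban, CMP **109** (1987) 249–301, (0.23) p. 256, (1.18) p. 263, (2.12)–(2.14)
p. 268; [Balaban1988RG2Cluster] T. Bałaban, CMP **116** (1988) 1–22, (1.34)–(1.36) p. 9, Lemma 3 (2.38) p. 20, (2.41) p. 21.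
Summits-side NEW work (LEAN PLACEMENT RULE); imports `NE9BridgeSizeInduction` BY NAME; modifies nothing.
-/

noncomputable section

namespace Summit.QuantumFields.BalabanUV.T4Continuum.NE9BridgeSizeInductionOn

open scoped BigOperators
open Literature.Probability.LatticeModels
open Literature.MathematicalPhysics.QuantumFieldTheory.Balaban1983to89
open Literature.MathematicalPhysics.QuantumFieldTheory.Balaban1983to89.T4OutputRate
open Literature.MathematicalPhysics.QuantumFieldTheory.Balaban1983to89.T4ActivityLipschitz
open Literature.MathematicalPhysics.QuantumFieldTheory.Balaban1983to89.T4HistoryLipschitzRecursion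
open Literature.MathematicalPhysics.QuantumFieldTheory.Balaban1983to89.T4HistoryLipschitzOuter
open Literature.MathematicalPhysics.QuantumFieldTheory.Balaban1983to89.T4HistoryLipschitzActivity
open Literature.MathematicalPhysics.QuantumFieldTheory.Balaban1983to89.T4HistoryLipschitzActivity (ClusterGeom)
open Literature.MathematicalPhysics.QuantumFieldTheory.Balaban1983to89.T4HistoryLipschitzSegment
open Summit.QuantumFields.BalabanUV.T4Continuum.NE9LastCouplingBridge
open Summit.QuantumFields.BalabanUV.T4Continuum.NE9VacuumSubtractedBridge

variable {C : Carriers} (G : ClusterGeom C) {Bg : Type} {Pot : Type*} [NormedAddCommGroup Pot]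

/-! ## §1 The size induction under the vacuum-subtracted representation, box read-out AT ARISING TABLES ONLY -/

/-- **SIZE INDUCTION, VACUUM-SUBTRACTED, `hboxOn`** — `NE9BridgeSizeInduction.termSize_of_recursion_vacSub` with the box read-out
(R′) asked only at the ARISING tables `T k g′ (E g)`, `g, g′ ∈ W` (its two call sites): EVERY history obeys `TermSize E W κ N` AND
every occurring (hybrid) table is admissible.  Same strong induction on the creation step.
[cite: Balaban1987RG1, (0.23) p.256, (1.18) p.263, (2.14) p.268; Balaban1988RG2Cluster, (1.34)-(1.36) p.9, (2.41) p.21] -/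
theorem termSize_of_recursion_vacSub_on {ι : Type} {E : Functional C Bg} {W : Set (ℕ → ℝ)} {Adm : Set (Bg → C.Dom → ℝ)}
    {T : ℕ → (ℕ → ℝ) → (Bg → C.Dom → ℝ) → ι → ℝ} {Ψ : ℕ → ℝ → (ι → ℝ) → Bg → C.Dom → ℝ}
    {act : ℕ → ℝ → Bg → Pot → G.P → ℂ} {𝒜 : ℕ → Set Pot} {n : ℕ → ℝ → Bg → G.P → ℝ} {lip : ℕ → ℝ} {a d : G.P → ℝ}
    {δ : C.Dom → ℝ} {B₀ p₀ N : ℕ → ℝ} {κ : ℝ} {wt : ℕ → ι → ℝ} {τ : ℕ → ℕ → ℝ} (ρ : ℕ → (ι → ℝ) → Pot) (U₀ : Bg)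
    (explZ : ℕ → Bg → C.Dom → ℝ) (hAdm : AdmissibleTerms E W Adm) (hsize : ChannelSizeNN Adm T κ wt τ)
    (hfac : Factorises E W T Ψ) (hK : TwoPointKP G W act 𝒜 n lip a d) (hdec : G.DecayExtract δ d)
    (hpin : G.PinBudget a δ B₀ κ)
    (hreprV : ∀ (k : ℕ) (s : ℝ) (P : ι → ℝ) (U : Bg) (X : C.Dom),
      Ψ k s P U X = (G.newTerm act k s U X (ρ k P)).re - (G.newTerm act k s U₀ X (ρ k P)).re + explZ k U X)
    (hexplZ : ∀ (k : ℕ) (U : Bg) (X : C.Dom), C.scale X = k + 1 → |explZ k U X| ≤ Real.exp (-(κ * C.d X)) * p₀ k)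
    (hbase : ∀ g ∈ W, ∀ (U : Bg) (X : C.Dom), C.scale X = 0 → |E g U X| ≤ Real.exp (-(κ * C.d X)) * N 0)
    (hNsucc : ∀ j, p₀ j + 2 * B₀ j ≤ N (j + 1)) (hNnn : ∀ j, 0 ≤ N j)
    (hboxOn : ∀ (k : ℕ), ∀ g ∈ W, ∀ g' ∈ W,
      (∀ y, |T k g' (E g) y| ≤ wt k y * sizeRadius τ N k) → ρ k (T k g' (E g)) ∈ 𝒜 k) :
    TermSize E W κ N ∧ ∀ g ∈ W, ∀ g' ∈ W, ∀ k : ℕ, ρ k (T k g' (E g)) ∈ 𝒜 k := by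
  have main : ∀ (m : ℕ), ∀ g ∈ W, ∀ (U : Bg) (X : C.Dom), C.scale X ≤ m →
      |E g U X| ≤ Real.exp (-(κ * C.d X)) * N (C.scale X) := by
    intro m
    induction m with
    | zero =>
        intro g hg U X hX
        have h0 : C.scale X = 0 := Nat.le_zero.mp hX
        rw [h0]
        exact hbase g hg U X h0
    | succ k ih =>
        intro g hg U X hX
        rcases Nat.lt_or_ge (C.scale X) (k + 1) with hlt | hge
        · exact ih g hg U X (Nat.lt_succ_iff.mp hlt)
        · have hXk : C.scale X = k + 1 := le_antisymm hX hge
          have hocc : ρ k (T k g (E g)) ∈ 𝒜 k :=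
            hboxOn k g hg g hg fun y => hsize k g (E g) (hAdm.1 g hg) N hNnn (fun U' X' hX' => ih g hg U' X' hX') y
          have hnew : ∀ V : Bg, |(G.newTerm act k (g k) V X (ρ k (T k g (E g)))).re| ≤ B₀ k * Real.exp (-(κ * C.d X)) :=
            fun V => (Complex.abs_re_le_norm _).trans (norm_newTerm_le_of_twoPointKP G hK hdec hpin hg hXk (U := V) hocc)
          have he := hexplZ k U X hXk
          rw [hfac g hg k U X hXk, hXk, hreprV]
          calc |(G.newTerm act k (g k) U X (ρ k (T k g (E g)))).re - (G.newTerm act k (g k) U₀ X (ρ k (T k g (E g)))).re +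
                  explZ k U X|
              ≤ |(G.newTerm act k (g k) U X (ρ k (T k g (E g)))).re - (G.newTerm act k (g k) U₀ X (ρ k (T k g (E g)))).re| +
                  |explZ k U X| := abs_add_le _ _
            _ ≤ (|(G.newTerm act k (g k) U X (ρ k (T k g (E g)))).re| +
                  |(G.newTerm act k (g k) U₀ X (ρ k (T k g (E g)))).re|) + |explZ k U X| :=
                add_le_add (abs_sub _ _) le_rfl
            _ ≤ (B₀ k * Real.exp (-(κ * C.d X)) + B₀ k * Real.exp (-(κ * C.d X))) + Real.exp (-(κ * C.d X)) * p₀ k :=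
                add_le_add (add_le_add (hnew U) (hnew U₀)) he
            _ = Real.exp (-(κ * C.d X)) * (p₀ k + 2 * B₀ k) := by ring
            _ ≤ Real.exp (-(κ * C.d X)) * N (k + 1) := mul_le_mul_of_nonneg_left (hNsucc k) (Real.exp_nonneg _)
  have hT : TermSize E W κ N := fun g hg U X => main (C.scale X) g hg U X le_rfl
  exact ⟨hT, fun g hg g' hg' k =>
    hboxOn k g hg g' hg' fun y => hsize k g' (E g) (hAdm.1 g hg) N hNnn (fun U X _ => hT g hg U X) y⟩

/-! ## §2 The vacuum-subtracted END with the occupation DERIVED from `hboxOn` -/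

/-- **NE9 ∧ FADING MEMORY ∧ THE TERM SIZE BOUND, occupation DERIVED (vacuum-subtracted representation), `hboxOn`** —
`NE9BridgeSizeInduction.ne9_and_fadingMemory_of_couplingTwoPoint_vacSub_sizeInduction` VERBATIM except that (R′) is the box
read-out at ARISING tables `hboxOn`; §1 supplies `hocc`, the NE9 half is `NE9VacuumSubtractedBridge.…_vacSub` unchanged.
[cite: Balaban1987RG1, (1.18) p.263 and (2.12)-(2.14) p.268; Balaban1988RG2Cluster, (1.34)-(1.36) p.9, Lemma 3 (2.38) p.20, (2.41) p.21] -/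
theorem ne9_and_fadingMemory_of_couplingTwoPoint_vacSub_sizeInduction_on [NormedSpace ℂ Pot] {ι : Type} {E : Functional C Bg}
    {W : Set (ℕ → ℝ)} {Adm : Set (Bg → C.Dom → ℝ)} {T : ℕ → (ℕ → ℝ) → (Bg → C.Dom → ℝ) → ι → ℝ}
    {Ψ : ℕ → ℝ → (ι → ℝ) → Bg → C.Dom → ℝ} {act : ℕ → ℝ → Bg → Pot → G.P → ℂ} {𝒜 : ℕ → Set Pot}
    {n : ℕ → ℝ → Bg → G.P → ℝ} {lip clip : ℕ → ℝ} {a d : G.P → ℝ} {δ : C.Dom → ℝ}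
    {κ B lipbar clipbar qTbar τbar ω : ℝ} {wt : ℕ → ι → ℝ} {τ : ℕ → ℕ → ℝ} {qT p₀ N : ℕ → ℝ}
    (ρ : ℕ → (ι → ℝ) → Pot) (U₀ : Bg) (explZ : ℕ → Bg → C.Dom → ℝ) (h0 : ScaleZeroFree E W)
    (hAdm : AdmissibleTerms E W Adm) (hres : AdmRestrict Adm) (hadd : ChannelAdditive Adm T)
    (hsum : ChannelStepSum Adm T) (hstep : ChannelSizeAtStepNN Adm T κ wt τ) (hfac : Factorises E W T Ψ)
    (hclip0 : ∀ k, 0 ≤ clip k)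
    (hCup : ∀ g ∈ W, ∀ g' ∈ W, ∀ (k : ℕ) (U : Bg) (X : C.Dom), C.scale X = k + 1 → ∀ Q ∈ 𝒜 k, ∀ γ ∈ G.vol X,
      ‖act k (g k) U Q γ‖ ≤ n k (g' k) U γ ∧
        ‖act k (g k) U Q γ - act k (g' k) U Q γ‖ ≤ clip k * |g k - g' k| * n k (g' k) U γ)
    (hqT0 : ∀ k, 0 ≤ qT k)
    (hTcup : ∀ g ∈ W, ∀ g' ∈ W, ∀ (k : ℕ) (y : ι), |T k g (E g) y - T k g' (E g) y| ≤ wt k y * (qT k * |g k - g' k|))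
    (hreprV : ∀ (k : ℕ) (s : ℝ) (P : ι → ℝ) (U : Bg) (X : C.Dom),
      Ψ k s P U X = (G.newTerm act k s U X (ρ k P)).re - (G.newTerm act k s U₀ X (ρ k P)).re + explZ k U X)
    (hclipb : ∀ k, clip k ≤ clipbar) (hqTb : ∀ k, qT k ≤ qTbar)
    (hK : TwoPointKP G W act 𝒜 n lip a d) (hdec : G.DecayExtract δ d) (hpin : G.PinBudget a δ (fun _ => B) κ)
    (hρ : ∀ (k : ℕ) (P P' : ι → ℝ) (M : ℝ), (∀ y, |P y - P' y| ≤ wt k y * M) → ‖ρ k P - ρ k P'‖ ≤ M)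
    -- the size-induction data (B0), (XZ), (N′), (R′-on) — in place of the occupation hypothesis `hocc`
    (hexplZ : ∀ (k : ℕ) (U : Bg) (X : C.Dom), C.scale X = k + 1 → |explZ k U X| ≤ Real.exp (-(κ * C.d X)) * p₀ k)
    (hbase : ∀ g ∈ W, ∀ (U : Bg) (X : C.Dom), C.scale X = 0 → |E g U X| ≤ Real.exp (-(κ * C.d X)) * N 0)
    (hNsucc : ∀ j, p₀ j + 2 * B ≤ N (j + 1)) (hNnn : ∀ j, 0 ≤ N j)
    (hboxOn : ∀ (k : ℕ), ∀ g ∈ W, ∀ g' ∈ W,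
      (∀ y, |T k g' (E g) y| ≤ wt k y * sizeRadius τ N k) → ρ k (T k g' (E g)) ∈ 𝒜 k)
    (hB : 0 ≤ B) (hlipb : ∀ k, lip k ≤ lipbar) (hτbar : 0 ≤ τbar) (hω : 0 ≤ ω) (hpos : 0 < ω + 8 * lipbar * B * τbar)
    (hτ : ∀ k j, j ≤ k → 0 ≤ τ k j ∧ τ k j ≤ τbar * ω ^ (k - j)) :
    TermSize E W κ N ∧
      NE9 E W κ (prodModuli (8 * clipbar * B + 8 * lipbar * B * qTbar) fun _ => ω + 8 * lipbar * B * τbar) ∧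
        FadingMemory ((8 * clipbar * B + 8 * lipbar * B * qTbar) / (ω + 8 * lipbar * B * τbar))
          (ω + 8 * lipbar * B * τbar)
          (prodModuli (8 * clipbar * B + 8 * lipbar * B * qTbar) fun _ => ω + 8 * lipbar * B * τbar) := by
  obtain ⟨hT, hocc⟩ := termSize_of_recursion_vacSub_on G ρ U₀ explZ hAdm (channelSizeNN_of_perStepNN hres hsum hstep) hfac
    hK hdec hpin hreprV hexplZ hbase hNsucc hNnn hboxOn
  exact ⟨hT, ne9_and_fadingMemory_of_couplingTwoPoint_vacSub G ρ U₀ explZ h0 hAdm hres hadd hsum hstep hfac hclip0 hCup hqT0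
    hTcup hreprV hclipb hqTb hK hdec hpin hρ hocc hB hlipb hτbar hω hpos hτ⟩

/-! ## §3 The landed binder implies the re-cut one -/

omit [NormedAddCommGroup Pot] in
/-- [folklore] **`hbox ⇒ hboxOn`**: the box read-out for all tables of the box implies the box read-out at arising tables — every
landed END of the lineage is a corollary of its `…_on` twin (nothing landed is weakened). -/
theorem hboxOn_of_hbox {ι : Type} {E : Functional C Bg} {W : Set (ℕ → ℝ)} {T : ℕ → (ℕ → ℝ) → (Bg → C.Dom → ℝ) → ι → ℝ}
    {𝒜 : ℕ → Set Pot} {wt : ℕ → ι → ℝ} {τ : ℕ → ℕ → ℝ} {N : ℕ → ℝ} (ρ : ℕ → (ι → ℝ) → Pot)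
    (hbox : ∀ (k : ℕ) (P : ι → ℝ), (∀ y, |P y| ≤ wt k y * sizeRadius τ N k) → ρ k P ∈ 𝒜 k) :
    ∀ (k : ℕ), ∀ g ∈ W, ∀ g' ∈ W, (∀ y, |T k g' (E g) y| ≤ wt k y * sizeRadius τ N k) → ρ k (T k g' (E g)) ∈ 𝒜 k :=
  fun k _ _ _ _ hP => hbox k _ hP

end Summit.QuantumFields.BalabanUV.T4Continuum.NE9BridgeSizeInductionOn

end
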